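import Summits.ABC.IUTFork.Joshi.RosettaFragment1
import Summits.ABC.IUTFork.Joshi.RosettaFragment3
import HarnessLib

/-!
# [J-III] §8.3 ↔ §8.5: the Fragment 1 local datum SUPPLIES E-t17's Fragment 3 `StripDatum` (merge-debt T-16 ↔ T-17)

Sequel of `Summits/ABC/IUTFork/Joshi/RosettaFragment1.lean` (abc-iut-E-t16, slot T-16, p429272) and
`Summits/ABC/IUTFork/Joshi/RosettaFragment3.lean` (abc-iut-E-t17, slot T-17, p428939). K. Joshi, arXiv:2401.13508v4
(bib `Joshi2024ATS3`, UNREFEREED, claim status `disputed`; typed ≠ proved ≠ endorsed; no side taken on [IUTchIII]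
Cor. 3.12 or on any author). E-t17's SIGNATURE `ATS3.StripDatum Pi G Lbar Kv` («what the local holomorphoid
`hol_{X/L_v}(ℂ♭_{p_v})_{y_v}` provides at `v` for Rosetta Stone Fragment 3», §8.5 p.81 l.8–57, table p.82; §8.6 p.83
l.26–27) abstracts the Galois side as TYPE PARAMETERS — `G = G_{L_v;K_v}` «the absolute Galois group of `L̄_v/L_v`,
`L̄_v` the algebraic closure of `L_v` in `K_v`», `gal : G →* RingAut L̄_v`, `emb : L̄_v →+* K_v` — and records the
merge-debt «`Π`, `G`, the holomorphoid index = E-t1 / T-16 carriers». THIS FILE PAYS IT: from a T-16 local datum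
`H : Rosetta.LocalHolDatum L_v U Γ` (Prop. 8.3.1.1: `L̄_{v;K_v} :=` Mathlib's `algebraicClosure L_v K_v`,
`G_{L_v;K_v} :=` its automorphism group `PrefGal`, `Π^temp ↠ G` the field `aug`; `K_v = U.K` E-t1's untilt), together
with the two §8.5-specific inputs that Fragment 1 does not carry — the Tate quasi-period `q ∈ L_v` of `C/L_v` with
valuation `< 1` (p.83 l.45 – p.84 l.2) and the prime `ℓ` of §3.3 — and ONE named analytic hypothesis, E-t17's own
field `abs_gal` «`|σ(x)|_{K_v} = |x|_{K_v}` for `σ ∈ G_{L_v;K_v}`, `x ∈ L̄_v`» (uniqueness of the extension of `|−|_v`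
from the complete field `L_v` to its algebraic closure — classical; NOT re-proved here, forwarded verbatim as the
hypothesis `GalIsometric`), we CONSTRUCT `H.toStripDatum … : ATS3.StripDatum Γ (PrefGal L_v U.K) L̄_{v;K_v} U.K`
(`Pi := Γ`, `proj := H.aug`, `emb :=` the inclusion, `Lv :=` the image of `L_v`, `gal :=` the tautological action,
`absK := ‖−‖_{K_v}` as an absolute value). PROVED on the way: the Galois action fixes `L_v` (`AlgEquiv.commutes`),
`0 < |q|_{K_v} < 1` from `q ≠ 0`, `v(q) < 1` and the unit-ball field `norm_algebraMap_le_one_iff` alone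
(`norm_algebraMap_lt_one_of_valuation_lt_one`), and the bookkeeping identities `toStripDatum_proj/_q/_absK`. Hence
every Fragment-3 row E-t17 defines on a `StripDatum` (`stripHol`, `stripMono`, `stripTimesMu`, …, `realify`,
`absTate`) is available on Joshi's local holomorphoid datum of Fragment 1 — the two dictionary files compose.
Standard axioms only; sorry-free; nothing of Joshi's text is asserted. bears_on: LADDER-ABC:A2.E.
-/

noncomputable section

open scoped ValuativeRel

namespace Summit.ABC.IUTFork.Joshi.Rosetta

open Summit.ABC.IUTFork.Joshi.ATS3

/-! ## 1. The norm of the untilt as an absolute value; `|q|_{K_v} < 1` from `v(q) < 1` -/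

/-- `‖−‖_{K}` of a normed field as a bundled `ℝ`-valued absolute value (E-t17's `StripDatum.absK : AbsoluteValue Kv ℝ`
«`|−|_{K_{y_v}}` provided by [Fargues–Fontaine]», §8.6.1 p.84 l.5–7). [claim: Joshi2024ATS3, status: disputed] -/
def absOfNorm (K : Type) [NormedField K] : AbsoluteValue K ℝ where
  toFun x := ‖x‖
  map_mul' := norm_mul
  nonneg' := norm_nonneg
  eq_zero' := fun _ => norm_eq_zero
  add_le' := norm_add_le

/-- PROVED: `absOfNorm` is the norm. -/
@[simp] theorem absOfNorm_apply (K : Type) [NormedField K] (x : K) : absOfNorm K x = ‖x‖ := rfl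

section Datum

variable {p : ℕ} [Fact p.Prime] {Lv : Type} [Field Lv] [ValuativeRel Lv] {U : Untilt p} [Algebra Lv U.K]
  {Γ : Type} [Group Γ] [TopologicalSpace Γ]

/-- PROVED: from the unit-ball field ALONE (`‖ι x‖ ≤ 1 ↔ x ∈ 𝒪_{L_v}`): an element of valuation `< 1` has norm `< 1`
in `K_v` (if `x ≠ 0` then `x⁻¹ ∉ 𝒪_{L_v}`, so `‖ι x⁻¹‖ > 1`). Used for the Tate parameter `q`. -/
theorem norm_algebraMap_lt_one_of_valuation_lt_one (H : LocalHolDatum Lv U Γ) {x : Lv}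
    (hx : ValuativeRel.valuation Lv x < 1) : ‖algebraMap Lv U.K x‖ < 1 := by
  by_cases hx0 : x = 0
  · simp [hx0]
  have hxinv : ¬ (x⁻¹ ∈ 𝒪[Lv]) := by
    intro h
    have h1 : ValuativeRel.valuation Lv x⁻¹ ≤ 1 := h
    rw [map_inv₀] at h1
    have hpos : 0 < ValuativeRel.valuation Lv x := by
      rw [Valuation.pos_iff]; exact hx0
    have : (1 : ValuativeRel.ValueGroupWithZero Lv) ≤ ValuativeRel.valuation Lv x := by
      simpa using (inv_le_one₀ hpos).mp h1
    exact absurd hx (not_lt.mpr this)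
  have hgt : 1 < ‖algebraMap Lv U.K x⁻¹‖ := by
    by_contra hle
    exact hxinv ((H.norm_algebraMap_le_one_iff x⁻¹).mp (not_lt.mp hle))
  rw [map_inv₀, norm_inv] at hgt
  have hnpos : 0 < ‖algebraMap Lv U.K x‖ := by
    rw [norm_pos_iff]; exact (map_ne_zero _).mpr hx0
  exact (one_lt_inv₀ hnpos).mp hgt

/-- **E-t17's field `abs_gal` as a named hypothesis** (RosettaFragment3 `StripDatum.abs_gal`: «`|σ(x)|_{L̄_v} = |x|_{L̄_v}`
for `σ ∈ G_{L_v;K_v}` — the classical uniqueness of the extension of `|−|_v` from the complete field `L_v` to its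
algebraic closure», used implicitly p.82 when `G` acts on `𝒪_{L̄_v}`): the Galois group of the preferred algebraic
closure acts by isometries for the norm of the untilt. Forwarded, not re-proved. [claim: Joshi2024ATS3, status: disputed] -/
def GalIsometric (Lv : Type) [Field Lv] (U : Untilt p) [Algebra Lv U.K] : Prop :=
  ∀ (σ : PrefGal Lv U.K) (x : PrefAlgClosure Lv U.K), ‖((σ x : PrefAlgClosure Lv U.K) : U.K)‖ = ‖(x : U.K)‖

namespace LocalHolDatum

/-- **The T-16 local datum supplies E-t17's Fragment-3 `StripDatum`** (§8.5 table p.82; §8.6 p.83 l.26–27 «`G_{L_v;K_v}`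
= the absolute Galois group of `L̄_v/L_v`, `L̄_v` the algebraic closure of `L_v` in `K_v`»; p.83 l.45 – p.84 l.2 the Tate
quasi-period `q`): `Pi := Γ = Π^temp_{X/L_v;K_v}`, `G := G_{L_v;K_v}`, `Lbar := L̄_{v;K_v}`, `Kv := K_v`, `proj := aug`
(Thm. 2.4.1 (2)(a)), `emb` the inclusion, `Lv` the image of `L_v`, `gal` the tautological action, `absK := ‖−‖_{K_v}`,
`q := ` the given `q ∈ L_v` (`q ≠ 0`, `v(q) < 1`), `ell := ℓ`; the one analytic input `abs_gal` is the hypothesis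
`GalIsometric`. [claim: Joshi2024ATS3, status: disputed] -/
def toStripDatum (H : LocalHolDatum Lv U Γ) (hgal : GalIsometric Lv U) (q : Lv) (hq0 : q ≠ 0)
    (hq1 : ValuativeRel.valuation Lv q < 1) (ℓ : ℕ) :
    StripDatum Γ (PrefGal Lv U.K) (PrefAlgClosure Lv U.K) U.K where
  proj := H.aug
  proj_surjective := H.aug_surjective
  emb := (toKv Lv U.K).toRingHom
  Lv := (algebraMap Lv (PrefAlgClosure Lv U.K)).fieldRange
  gal := MulSemiringAction.toRingAut (PrefGal Lv U.K) (PrefAlgClosure Lv U.K)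
  gal_fix g x hx := by
    obtain ⟨a, rfl⟩ := RingHom.mem_fieldRange.mp hx
    rw [MulSemiringAction.toRingAut_apply]
    show g • algebraMap Lv (PrefAlgClosure Lv U.K) a = algebraMap Lv (PrefAlgClosure Lv U.K) a
    rw [AlgEquiv.smul_def, AlgEquiv.commutes]
  absK := absOfNorm U.K
  abs_gal g x := by
    rw [MulSemiringAction.toRingAut_apply]
    exact hgal g x
  q := algebraMap Lv (PrefAlgClosure Lv U.K) q
  q_mem := RingHom.mem_fieldRange.mpr ⟨q, rfl⟩
  absK_q_pos := by
    rw [absOfNorm_apply, norm_pos_iff]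
    exact (map_ne_zero _).mpr ((map_ne_zero _).mpr hq0)
  absK_q_lt_one := by
    rw [absOfNorm_apply]
    have : ((toKv Lv U.K).toRingHom (algebraMap Lv (PrefAlgClosure Lv U.K) q) : U.K) = algebraMap Lv U.K q :=
      (IsScalarTower.algebraMap_apply Lv (PrefAlgClosure Lv U.K) U.K q).symm
    rw [this]
    exact norm_algebraMap_lt_one_of_valuation_lt_one H hq1
  ell := ℓ

variable (H : LocalHolDatum Lv U Γ) (hgal : GalIsometric Lv U) (q : Lv) (hq0 : q ≠ 0)
  (hq1 : ValuativeRel.valuation Lv q < 1) (ℓ : ℕ)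

/-- PROVED: the strip datum's quotient map `Π^temp ↠ G` (row `D ⊢ G_v`, p.82 l.12) IS the Fragment-1 augmentation. -/
theorem toStripDatum_proj : (H.toStripDatum hgal q hq0 hq1 ℓ).proj = H.aug := rfl

/-- PROVED: the strip datum's Tate parameter is the image of the given `q ∈ L_v` and its prime is `ℓ`. -/
theorem toStripDatum_q_ell : (H.toStripDatum hgal q hq0 hq1 ℓ).q = algebraMap Lv (PrefAlgClosure Lv U.K) q ∧
    (H.toStripDatum hgal q hq0 hq1 ℓ).ell = ℓ := ⟨rfl, rfl⟩

/-- PROVED: the strip datum's valuation on `K_v` is the norm of the untilt, so E-t17's `absTate` is `‖q‖_{K_v}` and its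
`O^▷_{L̄_v}` (`StripDatum.OTri`: `x ≠ 0 ∧ |x| ≤ 1`) is cut out by the unit ball of `K_v`. -/
theorem toStripDatum_absK (x : U.K) : (H.toStripDatum hgal q hq0 hq1 ℓ).absK x = ‖x‖ := rfl

/-- PROVED: on the composed datum, E-t17's monoid `O^▷_{L̄_v}` (`StripDatum.OTri`: `x ≠ 0 ∧ |x|_{K_v} ≤ 1`) contains
every nonzero element of `L̄_{v;K_v}` of norm `≤ 1` — in particular (with `norm_le_one_of_mem_integersClosure` of
`RosettaFragment1Bridges.lean`, p429586) the Fragment-1 monoid `𝒪^⊳_{L̄_{v;K_v}}` of the Frobenius-like `TM`-pair: both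
typings of «`G ↷ O^▷`» agree on the algebraic-integer side (the converse inclusion «unit ball ∩ L̄_v ⊆ integral
closure of `𝒪_{L_v}`» is the henselian/completeness statement, not typed here). -/
theorem mem_OTri_of_norm_le_one {x : PrefAlgClosure Lv U.K} (hx0 : x ≠ 0) (hx1 : ‖(x : U.K)‖ ≤ 1) :
    x ∈ (H.toStripDatum hgal q hq0 hq1 ℓ).OTri :=
  ⟨hx0, hx1⟩

end LocalHolDatum

end Datum

end Summit.ABC.IUTFork.Joshi.Rosetta

end
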